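import Mathlib
import Summits.NavierStokesRegularity.NavierStokesRegularity.Theses.SubOnsagerCeiling
import Summits.NavierStokesRegularity.NavierStokesRegularity.Theorems.SubOnsagerCeilingDefs
import Summits.NavierStokesRegularity.NavierStokesRegularity.Theorems.TaoLadderRungTwoBreakBlowupRigidityOneViscousScaling
import HarnessLib

/-!
# Unit viscosity suffices: the `ν`-uniform KP barriers are LARGE-DATA statements at viscosity `ν = 1`
# (helper file for the crux `SubOnsagerCeiling.ForwardTailCeilingKP`, stmt-NavierStokesRegularity-27057, `--supports`;
# hand leafhand-ns-subonsagerceiling-4 gen 25 — a by-name NORMAL FORM, no new analysis; def-free)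

The crux `ForwardTailCeilingKP` (item 27057), its per-table currencies `ShellBarrierAt` / `CeilingAt`
(`Theorems/SubOnsagerCeilingDefs.lean`) and the registered stubs `stub_primaryGradedLargeRatio` /
`stub_primaryGradedSmallRatio` (skeleton `Cruxes/ForwardTailCeilingKP/Lines/kp_shell_barrier.lean`, whose primary barrier is
`ShellBarrierAt` on the level-`0` modes, `Theorems/SubOnsagerCeilingKPBarrierCurrency.lean`) all quantify
`∃ θ > 1/2, ∃ C (or D) ≥ 0` BEFORE `∀ ν > 0` — a VISCOSITY-UNIFORM sub-Onsager bound along the honest non-negative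
`ν`-viscous solutions of the model lattice `X' = quadTerm ε₀ α X − ν(1+ε₀)^{2k}X` from one-shell data `X₀`.

This file records, kernel-checked, that the quantifier `∀ ν > 0` in all of them may be replaced by the single value
`ν = 1` (with the datum `X₀` still arbitrary): the lattice is covariant under the amplitude–time scaling
`(X, ν, X₀, s) ↦ (c·X(c·), cν, cX₀, s/c)` (`c > 0`; the quadratic nonlinearity and the linear dissipation both pick up
the factor `c²`, tree lemma `BlowupRigidityOne.quadTerm_ampTimeScale`), the class of honest solutions (datum, no negative
shells, weighted sup bound, continuity, `HasDerivWithinAt` on `[0,s]`, signs on shells `≥ 1`) is mapped to itself, and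
every bound of the three currencies is HOMOGENEOUS of degree two in the amplitude, so `c = ν⁻¹` reduces viscosity `ν`
to viscosity `1`:

* `ampTimeScale_datum`, `…_vanish`, `…_weighted`, `…_continuous`, `…_hasDerivWithinAt`, `…_nonneg`,
  `div_mem_Icc_of_mem_Icc` — transport of the six hypothesis groups of an honest solution under the scaling;
* **`shellBarrierAt_iff_unitViscosity`** — `ShellBarrierAt R ε₀ α` ↔ the same statement with `ν = 1`;
* **`ceilingAt_iff_unitViscosity`** — `CeilingAt R ε₀ α` ↔ the same statement with `ν = 1`;
* **`forwardTailCeilingKP_iff_unitViscosity`** — the CRUX `ForwardTailCeilingKP` ↔ the same statement with `ν = 1`.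

READING (for the planner / the repair census of item 27057).  «`θ, C` before `ν`» is not an extra uniformity to be
paid for separately: it is EQUIVALENT to a bound at fixed viscosity `ν = 1` that is uniform in the SIZE of the one-shell
datum (`E₀ = Σ½X₀²` arbitrary), i.e. to a scaling-critical large-data a priori estimate — the classical phrasing.  The
small-viscosity limit `ν ↓ 0` at fixed datum and the large-data limit `E₀ ↑ ∞` at fixed viscosity are the same limit
(parameter `X₀/ν`, as in `BlowupRigidityOne.exists_viscousGlobal_iff_unitViscosity` for global regularity).  Nothing in the
census of the stubs changes in substance (every invariant-region / front certificate of the hands is already `ν`-free);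
the lemma only removes one quantifier from every future certificate and from any re-typed crux.
HONEST FRAMING: symmetry bookkeeping about Tao-type MODEL lattice ODEs (route SubOnsagerCeiling, rung TL-M2Break); no stub,
crux or summit is proved here and nothing in this file bears on Navier–Stokes regularity.
[cite: Tao2016AveragedNS, §4 (4.8), (4.13) (homogeneity of the cascade nonlinearity; the viscous model equation)]
[cite: BarbatoMorandinRomito2011, §3.2 (the barrier shape `sup_t sup_n λₙ^{β−2+ε}Xₙ(t) ≤ δ⁻¹ sup_n λₙ^{β−2+ε}Xₙ(0)`)]
-/

noncomputable section

-- the summit and its single sub-problem share the name (CONVENTIONS §1)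
set_option linter.dupNamespace false

open Set

namespace Summit.NavierStokesRegularity.NavierStokesRegularity.Theorems.SubOnsagerCeiling.UnitViscosity

open Literature.Analysis.FluidPDE Literature.Analysis.FluidPDE.TaoCascade
open Summit.NavierStokesRegularity.NavierStokesRegularity.Theses.SubOnsagerCeiling
open Summit.NavierStokesRegularity.NavierStokesRegularity.Theorems.SubOnsagerCeiling
open Summit.NavierStokesRegularity.NavierStokesRegularity.Theorems.BlowupRigidityOne

/-! ## Transport of the honest-solution hypotheses under `(X, t) ↦ (c·X, t/c)` -/

/-- `t ↦ c t` maps `[0, s/c]` into `[0, s]` (`c > 0`). [folklore] -/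
theorem mul_mem_Icc_of_mem_Icc_div {c s t : ℝ} (hc : 0 < c) (ht : t ∈ Icc 0 (s / c)) :
    c * t ∈ Icc 0 s := by
  refine ⟨mul_nonneg hc.le ht.1, ?_⟩
  have := mul_le_mul_of_nonneg_left ht.2 hc.le
  rwa [mul_div_cancel₀ _ hc.ne'] at this

/-- `t ↦ t / c` maps `[0, s]` into `[0, s/c]` (`c > 0`). [folklore] -/
theorem div_mem_Icc_of_mem_Icc {c s t : ℝ} (hc : 0 < c) (ht : t ∈ Icc 0 s) :
    t / c ∈ Icc 0 (s / c) :=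
  ⟨div_nonneg ht.1 hc.le, div_le_div_of_nonneg_right ht.2 hc.le⟩

/-- Datum: the scaled family `c·X(c·)` starts from the one-shell datum `c·X₀`.
[cite: Tao2016AveragedNS, §4 (4.7)] -/
theorem ampTimeScale_datum {c : ℝ} {X₀ : Fin 4 → ℝ} {X : Fin 4 → ℤ → ℝ → ℝ}
    (hX0 : ∀ (i : Fin 4) (k : ℤ), X i k 0 = if k = 0 then X₀ i else 0) :
    ∀ (i : Fin 4) (k : ℤ), (fun i k t => c * X i k (c * t)) i k 0 = if k = 0 then c * X₀ i else 0 := by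
  intro i k
  simp only [mul_zero, hX0 i k]
  split_ifs <;> simp

/-- No negative shells: preserved. [cite: Tao2016AveragedNS, §4 (4.11)] -/
theorem ampTimeScale_vanish {c : ℝ} {X : Fin 4 → ℤ → ℝ → ℝ}
    (hXneg : ∀ (i : Fin 4) (k : ℤ), k < 0 → ∀ t : ℝ, X i k t = 0) :
    ∀ (i : Fin 4) (k : ℤ), k < 0 → ∀ t : ℝ, (fun i k t => c * X i k (c * t)) i k t = 0 := by
  intro i k hk t
  simp [hXneg i k hk]

/-- Weighted sup bound (4.5): preserved, constant `c·M`. [cite: Tao2016AveragedNS, §4 (4.5)] -/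
theorem ampTimeScale_weighted {ε₀ c : ℝ} (hc : 0 < c) {X : Fin 4 → ℤ → ℝ → ℝ}
    (hM : ∃ M : ℝ, ∀ (t : ℝ) (i : Fin 4) (k : ℤ), (1 + (1 + ε₀) ^ ((10 : ℝ) * k)) * |X i k t| ≤ M) :
    ∃ M : ℝ, ∀ (t : ℝ) (i : Fin 4) (k : ℤ),
      (1 + (1 + ε₀) ^ ((10 : ℝ) * k)) * |(fun i k t => c * X i k (c * t)) i k t| ≤ M := by
  obtain ⟨M, hM⟩ := hM
  refine ⟨c * M, fun t i k => ?_⟩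
  have h := mul_le_mul_of_nonneg_left (hM (c * t) i k) hc.le
  calc (1 + (1 + ε₀) ^ ((10 : ℝ) * k)) * |c * X i k (c * t)|
      = c * ((1 + (1 + ε₀) ^ ((10 : ℝ) * k)) * |X i k (c * t)|) := by
        rw [abs_mul, abs_of_pos hc]; ring
    _ ≤ c * M := h

/-- Continuity: preserved. [folklore] -/
theorem ampTimeScale_continuous {c : ℝ} {X : Fin 4 → ℤ → ℝ → ℝ}
    (hXc : ∀ (i : Fin 4) (k : ℤ), Continuous (X i k)) :
    ∀ (i : Fin 4) (k : ℤ), Continuous ((fun i k t => c * X i k (c * t)) i k) := by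
  intro i k
  exact continuous_const.mul ((hXc i k).comp (continuous_const.mul continuous_id))

/-- **The model equation is covariant**: if `X` solves the `ν`-viscous lattice on `[0,s]` (one-sided derivatives within
the window), then `c·X(c·)` solves the `cν`-viscous lattice on `[0, s/c]`.
[cite: Tao2016AveragedNS, §4 (4.8), (4.13)] -/
theorem ampTimeScale_hasDerivWithinAt {ε₀ ν c s : ℝ} (hc : 0 < c)
    {α : Fin 4 → Fin 4 → Fin 4 → ℤ × ℤ × ℤ → ℝ} {X : Fin 4 → ℤ → ℝ → ℝ}
    (hXd : ∀ (i : Fin 4) (k : ℤ), ∀ t ∈ Icc (0 : ℝ) s, HasDerivWithinAt (X i k)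
      (quadTerm ε₀ α X i k t - ν * (1 + ε₀) ^ ((2 : ℝ) * k) * X i k t) (Icc (0 : ℝ) s) t) :
    ∀ (i : Fin 4) (k : ℤ), ∀ t ∈ Icc (0 : ℝ) (s / c), HasDerivWithinAt ((fun i k t => c * X i k (c * t)) i k)
      (quadTerm ε₀ α (fun i k t => c * X i k (c * t)) i k t -
        (c * ν) * (1 + ε₀) ^ ((2 : ℝ) * k) * (fun i k t => c * X i k (c * t)) i k t) (Icc (0 : ℝ) (s / c)) t := by
  intro i k t ht
  have hmaps : MapsTo (fun u : ℝ => c * u) (Icc (0 : ℝ) (s / c)) (Icc (0 : ℝ) s) :=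
    fun u hu => mul_mem_Icc_of_mem_Icc_div hc hu
  have hlin : HasDerivWithinAt (fun u : ℝ => c * u) c (Icc (0 : ℝ) (s / c)) t := by
    simpa using (hasDerivWithinAt_id t (Icc (0 : ℝ) (s / c))).const_mul c
  have hcomp := ((hXd i k (c * t) (mul_mem_Icc_of_mem_Icc_div hc ht)).comp t hlin hmaps).const_mul c
  have heq : c * ((quadTerm ε₀ α X i k (c * t) - ν * (1 + ε₀) ^ ((2 : ℝ) * k) * X i k (c * t)) * c) =
      quadTerm ε₀ α (fun i k t => c * X i k (c * t)) i k t -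
        (c * ν) * (1 + ε₀) ^ ((2 : ℝ) * k) * (c * X i k (c * t)) := by
    rw [quadTerm_ampTimeScale]; ring
  rw [heq] at hcomp
  exact hcomp

/-- Signs on shells `≥ 1`: preserved on the scaled window. [cite: BarbatoMorandinRomito2011, §1.1 (positivity)] -/
theorem ampTimeScale_nonneg {c s : ℝ} (hc : 0 < c) {X : Fin 4 → ℤ → ℝ → ℝ}
    (hXpos : ∀ t ∈ Icc (0 : ℝ) s, ∀ (i : Fin 4) (k : ℤ), 1 ≤ k → 0 ≤ X i k t) :
    ∀ t ∈ Icc (0 : ℝ) (s / c), ∀ (i : Fin 4) (k : ℤ), 1 ≤ k → 0 ≤ (fun i k t => c * X i k (c * t)) i k t := by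
  intro t ht i k hk
  exact mul_nonneg hc.le (hXpos (c * t) (mul_mem_Icc_of_mem_Icc_div hc ht) i k hk)

/-- The energy of the scaled datum: `Σ ½(cX₀ j)² = c² Σ ½(X₀ j)²`. [folklore] -/
theorem energy_smul (c : ℝ) (X₀ : Fin 4 → ℝ) :
    ∑ j : Fin 4, (1 / 2 : ℝ) * (c * X₀ j) ^ 2 = c ^ 2 * ∑ j : Fin 4, (1 / 2 : ℝ) * X₀ j ^ 2 := by
  rw [Finset.mul_sum]
  exact Finset.sum_congr rfl fun j _ => by ring

/-! ## The shell barrier -/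

/-- **UNIT VISCOSITY SUFFICES FOR THE SHELL BARRIER.** `ShellBarrierAt R ε₀ α` (`θ, D` before `∀ ν > 0`) is
equivalent to the same statement at the single viscosity `ν = 1` with the one-shell datum free.
(`→`: specialise; `←`: given `ν`, apply the `ν = 1` statement to `ν⁻¹·X(ν⁻¹·)` and divide by `ν⁻²`.)
[cite: Tao2016AveragedNS, §4 (4.8), (4.13)] [cite: BarbatoMorandinRomito2011, §3.2] -/
theorem shellBarrierAt_iff_unitViscosity {R ε₀ : ℝ} {α : Fin 4 → Fin 4 → Fin 4 → ℤ × ℤ × ℤ → ℝ} :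
    ShellBarrierAt R ε₀ α ↔
    (InTableClass R α →
      (∀ (Y : Fin 4 → ℤ → ℝ → ℝ) (τ : ℝ), (∀ (j : Fin 4) (k : ℤ), 1 ≤ k → 0 ≤ Y j k τ) → ∀ δ : ℝ, 0 < δ →
        ∀ (i : Fin 4) (n : ℤ), 1 ≤ n → Y i n τ = 0 → 0 ≤ quadTerm δ α Y i n τ) →
      ∃ θ : ℝ, 1 / 2 < θ ∧ ∃ D : ℝ, 0 ≤ D ∧ ∀ (X₀ : Fin 4 → ℝ) (s : ℝ), 0 < s → ∀ X : Fin 4 → ℤ → ℝ → ℝ,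
        (∀ (i : Fin 4) (k : ℤ), X i k 0 = if k = 0 then X₀ i else 0) →
        (∀ (i : Fin 4) (k : ℤ), k < 0 → ∀ t : ℝ, X i k t = 0) →
        (∃ M : ℝ, ∀ (t : ℝ) (i : Fin 4) (k : ℤ), (1 + (1 + ε₀) ^ ((10 : ℝ) * k)) * |X i k t| ≤ M) →
        (∀ (i : Fin 4) (k : ℤ), Continuous (X i k)) →
        (∀ (i : Fin 4) (k : ℤ), ∀ t ∈ Icc (0 : ℝ) s, HasDerivWithinAt (X i k)
          (quadTerm ε₀ α X i k t - (1 + ε₀) ^ ((2 : ℝ) * k) * X i k t) (Icc (0 : ℝ) s) t) →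
        (∀ t ∈ Icc (0 : ℝ) s, ∀ (i : Fin 4) (k : ℤ), 1 ≤ k → 0 ≤ X i k t) →
        ∀ t ∈ Icc (0 : ℝ) s, ∀ (i : Fin 4) (k : ℕ),
          (1 + ε₀) ^ (2 * θ * (k : ℝ)) * ((1 / 2 : ℝ) * X i (k : ℤ) t ^ 2) ≤ D * (∑ j : Fin 4, (1 / 2 : ℝ) * X₀ j ^ 2)) := by
  constructor
  · intro h hT hO
    obtain ⟨θ, hθ, D, hD, H⟩ := h hT hO
    refine ⟨θ, hθ, D, hD, fun X₀ s hs X hX0 hXneg hM hXc hXd hXpos => ?_⟩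
    exact H 1 one_pos X₀ s hs X hX0 hXneg hM hXc (fun i k t ht => by rw [one_mul]; exact hXd i k t ht) hXpos
  · intro h hT hO
    obtain ⟨θ, hθ, D, hD, H⟩ := h hT hO
    refine ⟨θ, hθ, D, hD, fun ν hν X₀ s hs X hX0 hXneg hM hXc hXd hXpos t ht i k => ?_⟩
    set c : ℝ := ν⁻¹ with hc_def
    have hc : 0 < c := inv_pos.mpr hν
    have hcν : c * ν = 1 := inv_mul_cancel₀ hν.ne'
    have hYd := ampTimeScale_hasDerivWithinAt (ε₀ := ε₀) (ν := ν) (s := s) hc (α := α) (X := X) hXd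
    simp only [hcν, one_mul] at hYd
    have key := H (fun i => c * X₀ i) (s / c) (div_pos hs hc) (fun i k t => c * X i k (c * t))
      (ampTimeScale_datum hX0) (ampTimeScale_vanish hXneg) (ampTimeScale_weighted hc hM)
      (ampTimeScale_continuous hXc) hYd (ampTimeScale_nonneg hc hXpos) (t / c) (div_mem_Icc_of_mem_Icc hc ht) i k
    have hct : c * (t / c) = t := mul_div_cancel₀ t hc.ne'
    simp only [hct] at key
    rw [energy_smul] at key
    have hc2 : 0 < c ^ 2 := by positivity
    have key' : c ^ 2 * ((1 + ε₀) ^ (2 * θ * (k : ℝ)) * ((1 / 2 : ℝ) * X i (k : ℤ) t ^ 2)) ≤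
        c ^ 2 * (D * ∑ j : Fin 4, (1 / 2 : ℝ) * X₀ j ^ 2) := by
      have e1 : (1 + ε₀) ^ (2 * θ * (k : ℝ)) * ((1 / 2 : ℝ) * (c * X i (k : ℤ) t) ^ 2) =
          c ^ 2 * ((1 + ε₀) ^ (2 * θ * (k : ℝ)) * ((1 / 2 : ℝ) * X i (k : ℤ) t ^ 2)) := by ring
      have e2 : D * (c ^ 2 * ∑ j : Fin 4, (1 / 2 : ℝ) * X₀ j ^ 2) = c ^ 2 * (D * ∑ j : Fin 4, (1 / 2 : ℝ) * X₀ j ^ 2) := by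
        ring
      rw [e1, e2] at key
      exact key
    exact le_of_mul_le_mul_left key' hc2

/-! ## The tail ceiling -/

/-- **UNIT VISCOSITY SUFFICES FOR THE TAIL CEILING.** `CeilingAt R ε₀ α` (`θ, C` before `∀ ν > 0`; the per-table body of
the aside crux `OrthantTailCeiling`) is equivalent to the same statement at `ν = 1` with the datum free.
[cite: Tao2016AveragedNS, §4 (4.8), (4.13)] -/
theorem ceilingAt_iff_unitViscosity {R ε₀ : ℝ} {α : Fin 4 → Fin 4 → Fin 4 → ℤ × ℤ × ℤ → ℝ} :
    CeilingAt R ε₀ α ↔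
    (InTableClass R α →
      (∀ (Y : Fin 4 → ℤ → ℝ → ℝ) (τ : ℝ), (∀ (j : Fin 4) (k : ℤ), 1 ≤ k → 0 ≤ Y j k τ) → ∀ δ : ℝ, 0 < δ →
        ∀ (i : Fin 4) (n : ℤ), 1 ≤ n → Y i n τ = 0 → 0 ≤ quadTerm δ α Y i n τ) →
      ∃ θ : ℝ, 1 / 2 < θ ∧ ∃ C : ℝ, 0 ≤ C ∧ ∀ (X₀ : Fin 4 → ℝ) (s : ℝ), 0 < s → ∀ X : Fin 4 → ℤ → ℝ → ℝ,
        (∀ (i : Fin 4) (k : ℤ), X i k 0 = if k = 0 then X₀ i else 0) →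
        (∀ (i : Fin 4) (k : ℤ), k < 0 → ∀ t : ℝ, X i k t = 0) →
        (∃ M : ℝ, ∀ (t : ℝ) (i : Fin 4) (k : ℤ), (1 + (1 + ε₀) ^ ((10 : ℝ) * k)) * |X i k t| ≤ M) →
        (∀ (i : Fin 4) (k : ℤ), Continuous (X i k)) →
        (∀ (i : Fin 4) (k : ℤ), ∀ t ∈ Icc (0 : ℝ) s, HasDerivWithinAt (X i k)
          (quadTerm ε₀ α X i k t - (1 + ε₀) ^ ((2 : ℝ) * k) * X i k t) (Icc (0 : ℝ) s) t) →
        (∀ t ∈ Icc (0 : ℝ) s, ∀ (i : Fin 4) (k : ℤ), 1 ≤ k → 0 ≤ X i k t) →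
        ∀ n N : ℕ, n ≤ N → ∀ t ∈ Icc (0 : ℝ) s,
          ∑ k ∈ Finset.Icc n N, ∑ i : Fin 4, (1 / 2 : ℝ) * X i (k : ℤ) t ^ 2 ≤
            C * (∑ i : Fin 4, (1 / 2 : ℝ) * X₀ i ^ 2) * (1 + ε₀) ^ (-(2 * θ * (n : ℝ)))) := by
  constructor
  · intro h hT hO
    obtain ⟨θ, hθ, C, hC, H⟩ := h hT hO
    refine ⟨θ, hθ, C, hC, fun X₀ s hs X hX0 hXneg hM hXc hXd hXpos => ?_⟩
    exact H 1 one_pos X₀ s hs X hX0 hXneg hM hXc (fun i k t ht => by rw [one_mul]; exact hXd i k t ht) hXpos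
  · intro h hT hO
    obtain ⟨θ, hθ, C, hC, H⟩ := h hT hO
    refine ⟨θ, hθ, C, hC, fun ν hν X₀ s hs X hX0 hXneg hM hXc hXd hXpos n N hnN t ht => ?_⟩
    set c : ℝ := ν⁻¹ with hc_def
    have hc : 0 < c := inv_pos.mpr hν
    have hcν : c * ν = 1 := inv_mul_cancel₀ hν.ne'
    have hYd := ampTimeScale_hasDerivWithinAt (ε₀ := ε₀) (ν := ν) (s := s) hc (α := α) (X := X) hXd
    simp only [hcν, one_mul] at hYd
    have key := H (fun i => c * X₀ i) (s / c) (div_pos hs hc) (fun i k t => c * X i k (c * t))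
      (ampTimeScale_datum hX0) (ampTimeScale_vanish hXneg) (ampTimeScale_weighted hc hM)
      (ampTimeScale_continuous hXc) hYd (ampTimeScale_nonneg hc hXpos) n N hnN (t / c) (div_mem_Icc_of_mem_Icc hc ht)
    have hct : c * (t / c) = t := mul_div_cancel₀ t hc.ne'
    simp only [hct] at key
    rw [energy_smul] at key
    have hc2 : 0 < c ^ 2 := by positivity
    have e1 : ∑ k ∈ Finset.Icc n N, ∑ i : Fin 4, (1 / 2 : ℝ) * (c * X i (k : ℤ) t) ^ 2 =
        c ^ 2 * ∑ k ∈ Finset.Icc n N, ∑ i : Fin 4, (1 / 2 : ℝ) * X i (k : ℤ) t ^ 2 := by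
      rw [Finset.mul_sum]
      refine Finset.sum_congr rfl fun k _ => ?_
      rw [Finset.mul_sum]
      exact Finset.sum_congr rfl fun i _ => by ring
    have e2 : C * (c ^ 2 * ∑ i : Fin 4, (1 / 2 : ℝ) * X₀ i ^ 2) * (1 + ε₀) ^ (-(2 * θ * (n : ℝ))) =
        c ^ 2 * (C * (∑ i : Fin 4, (1 / 2 : ℝ) * X₀ i ^ 2) * (1 + ε₀) ^ (-(2 * θ * (n : ℝ)))) := by ring
    rw [e1, e2] at key
    exact le_of_mul_le_mul_left key hc2

/-! ## The crux itself -/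

/-- **UNIT VISCOSITY SUFFICES FOR THE CRUX.** The route crux `ForwardTailCeilingKP` (item 27057: `∃ S ⊇ S⁺(α), ∃ θ > 1/2,
∃ C ≥ 0` before `∀ ν > 0`) is equivalent, BY NAME, to the same statement at the single viscosity `ν = 1` with the
one-shell datum free: the `ν`-uniform forward-source tail ceiling is a large-data statement at unit viscosity.
[cite: Tao2016AveragedNS, §4 (4.8), (4.13)] -/
theorem forwardTailCeilingKP_iff_unitViscosity :
    ForwardTailCeilingKP ↔
    ∀ R : ℝ, 1 ≤ R → ∀ ε₀ : ℝ, 0 < ε₀ → ε₀ ≤ 1 → ∀ α : Fin 4 → Fin 4 → Fin 4 → ℤ × ℤ × ℤ → ℝ,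
      InTableClass R α →
      (∀ (Y : Fin 4 → ℤ → ℝ → ℝ) (τ : ℝ), (∀ (j : Fin 4) (k : ℤ), 1 ≤ k → 0 ≤ Y j k τ) → ∀ δ : ℝ, 0 < δ →
        ∀ (i : Fin 4) (n : ℤ), 1 ≤ n → Y i n τ = 0 → 0 ≤ quadTerm δ α Y i n τ) →
      (∀ a b i : Fin 4, a ≠ b → α a b i (0, 0, 1) = 0) →
      ∃ S : Finset (Fin 4), (∀ i, i ∉ S → ∀ j l : Fin 4, α i j l (0, 0, 1) = 0) ∧
      ∃ θ : ℝ, 1 / 2 < θ ∧ ∃ C : ℝ, 0 ≤ C ∧ ∀ (X₀ : Fin 4 → ℝ) (s : ℝ), 0 < s → ∀ X : Fin 4 → ℤ → ℝ → ℝ,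
        (∀ (i : Fin 4) (k : ℤ), X i k 0 = if k = 0 then X₀ i else 0) →
        (∀ (i : Fin 4) (k : ℤ), k < 0 → ∀ t : ℝ, X i k t = 0) →
        (∃ M : ℝ, ∀ (t : ℝ) (i : Fin 4) (k : ℤ), (1 + (1 + ε₀) ^ ((10 : ℝ) * k)) * |X i k t| ≤ M) →
        (∀ (i : Fin 4) (k : ℤ), Continuous (X i k)) →
        (∀ (i : Fin 4) (k : ℤ), ∀ t ∈ Icc (0 : ℝ) s, HasDerivWithinAt (X i k)
          (quadTerm ε₀ α X i k t - (1 + ε₀) ^ ((2 : ℝ) * k) * X i k t) (Icc (0 : ℝ) s) t) →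
        (∀ t ∈ Icc (0 : ℝ) s, ∀ (i : Fin 4) (k : ℤ), 1 ≤ k → 0 ≤ X i k t) →
        ∀ n N : ℕ, n ≤ N → ∀ t ∈ Icc (0 : ℝ) s,
          ∑ k ∈ Finset.Icc n N, ∑ i ∈ S, (1 / 2 : ℝ) * X i (k : ℤ) t ^ 2 ≤
            C * (∑ i : Fin 4, (1 / 2 : ℝ) * X₀ i ^ 2) * (1 + ε₀) ^ (-(2 * θ * (n : ℝ))) := by
  constructor
  · intro h R hR ε₀ h0 h1 α hT hO hD
    obtain ⟨S, hS, θ, hθ, C, hC, H⟩ := h R hR ε₀ h0 h1 α hT hO hD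
    refine ⟨S, hS, θ, hθ, C, hC, fun X₀ s hs X hX0 hXneg hM hXc hXd hXpos => ?_⟩
    exact H 1 one_pos X₀ s hs X hX0 hXneg hM hXc (fun i k t ht => by rw [one_mul]; exact hXd i k t ht) hXpos
  · intro h R hR ε₀ h0 h1 α hT hO hD
    obtain ⟨S, hS, θ, hθ, C, hC, H⟩ := h R hR ε₀ h0 h1 α hT hO hD
    refine ⟨S, hS, θ, hθ, C, hC, fun ν hν X₀ s hs X hX0 hXneg hM hXc hXd hXpos n N hnN t ht => ?_⟩
    set c : ℝ := ν⁻¹ with hc_def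
    have hc : 0 < c := inv_pos.mpr hν
    have hcν : c * ν = 1 := inv_mul_cancel₀ hν.ne'
    have hYd := ampTimeScale_hasDerivWithinAt (ε₀ := ε₀) (ν := ν) (s := s) hc (α := α) (X := X) hXd
    simp only [hcν, one_mul] at hYd
    have key := H (fun i => c * X₀ i) (s / c) (div_pos hs hc) (fun i k t => c * X i k (c * t))
      (ampTimeScale_datum hX0) (ampTimeScale_vanish hXneg) (ampTimeScale_weighted hc hM)
      (ampTimeScale_continuous hXc) hYd (ampTimeScale_nonneg hc hXpos) n N hnN (t / c) (div_mem_Icc_of_mem_Icc hc ht)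
    have hct : c * (t / c) = t := mul_div_cancel₀ t hc.ne'
    simp only [hct] at key
    rw [energy_smul] at key
    have hc2 : 0 < c ^ 2 := by positivity
    have e1 : ∑ k ∈ Finset.Icc n N, ∑ i ∈ S, (1 / 2 : ℝ) * (c * X i (k : ℤ) t) ^ 2 =
        c ^ 2 * ∑ k ∈ Finset.Icc n N, ∑ i ∈ S, (1 / 2 : ℝ) * X i (k : ℤ) t ^ 2 := by
      rw [Finset.mul_sum]
      refine Finset.sum_congr rfl fun k _ => ?_
      rw [Finset.mul_sum]
      exact Finset.sum_congr rfl fun i _ => by ring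
    have e2 : C * (c ^ 2 * ∑ i : Fin 4, (1 / 2 : ℝ) * X₀ i ^ 2) * (1 + ε₀) ^ (-(2 * θ * (n : ℝ))) =
        c ^ 2 * (C * (∑ i : Fin 4, (1 / 2 : ℝ) * X₀ i ^ 2) * (1 + ε₀) ^ (-(2 * θ * (n : ℝ)))) := by ring
    rw [e1, e2] at key
    exact le_of_mul_le_mul_left key hc2

end Summit.NavierStokesRegularity.NavierStokesRegularity.Theorems.SubOnsagerCeiling.UnitViscosity

end
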